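import Literature.Analysis.FluidPDE.LocalTypeIMorreyProofs
import Literature.Analysis.FluidPDE.LocalTypeIScaling
import Literature.Analysis.FluidPDE.LocalTypeIReverseTools
import Literature.Analysis.FluidPDE.LocalTypeICongr
import Literature.Analysis.FluidPDE.PineauVicolRSSChaeWolf
import Literature.Analysis.FluidPDE.ChaeWolfRemovingDSSLimit
import Literature.Analysis.FluidPDE.ClassicalSuitable
import Literature.Analysis.FluidPDE.BlowupLimitBounds
import HarnessLib

/-!
# Crux `FrequencyRigidity` (stmt-NavierStokesRegularity-2955), line `scaled-energy-split`:
# finite `𝐈(ℝ³ × ℝ₋)` of a rotated self-similar flow from one parabolic ball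

Helper file (`--supports stmt-NavierStokesRegularity-2955`; theorems only, sorry-free).  Stub
`stub_rssTypeIBoundOfBall`: let `(u, p)` be a classical solution of the unforced unit-viscosity
Navier–Stokes system on `(−∞, 0) × ℝ³` whose velocity is, for `t < 0`, Pineau–Vicol's rotated
self-similar (RSS) ansatz field `u(t, x) = (−t)^{−1/2} R(αs) U(R(−αs) x/√(−t))`,
`s = −log(−t)` (`pvAnsatz α (fun y _ => U y)`), and assume that `(u, p − c(t))` is a suitable
weak solution in the unit parabolic ball `Q((0,0), 1)` in Albritton–Barker's class (Def. 2.1)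
with the scaled energy `A` bounded on all sub-balls.  Then Albritton–Barker's quantity
`𝐈(ℝ³ × ℝ₋) = typeIBound (Iio 0 ×ˢ univ) u p ∇u` is finite.

Proof.
1. A–B Lemma 2.6 (`albrittonBarker2019_lemma_2_6_holds`, `A`-case) at the vertex, with the
   classical slice derivative `∇u` as weak gradient (`hasWeakSpatialGradientOn_of_contDiffOn`),
   gives `𝐈(Q((0,0), 1/2); u, p − c, ∇u) < ∞`; the gauge `c(t)` is invisible to `𝐈` on balls of
   the lower half space (`cknDOsc_sub_fun_time`: `D` is mean-free, the slices `p(t, ·)`, `t < 0`,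
   being continuous hence integrable on balls).
2. The ansatz field is discretely self-similar with some factor `λ > 1` (Pineau–Vicol 2026,
   Remark 1.5: `λ = e^{π/|α|}`, `isDiscretelySelfSimilar_pvAnsatz`), hence with every factor
   `λ^k` (`ChaeWolf.isDiscretelySelfSimilar_pow`); so on `t < 0` the NS zoom
   `λ^k u(λ^{2k} t, λ^k x)` of `u` is `u`, the zoom of `∇u` is `∇u`, and the zoomed pressure
   `λ^{2k} p(λ^{2k} t, λ^k x)` differs from `p` by a function of time (same velocity ⇒ same
   pressure gradient, `pressure_sub_apply_zero_eq_of_eventuallyEq`).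
   By the scale invariance `𝐈(Φ⁻¹ ω; zoom) = 𝐈(ω)` (`typeIBound_nsZoom`,
   `Φ⁻¹ Q(0, R) = Q(0, R/λ^k)`) and gauge invariance, `𝐈(Q(0, λ^k/2)) = 𝐈(Q(0, 1/2))`.
3. Every parabolic ball of the lower half space lies in some `Q(0, λ^k/2)`
   (`parabolicCylinder_subset_origin`), so `𝐈(ℝ³ × ℝ₋) ≤ 𝐈(Q(0, 1/2)) < ∞`.

## References

* D. Albritton, T. Barker, *On local Type I singularities of the Navier–Stokes equations and
  Liouville theorems*, J. Math. Fluid Mech. 21 (2019), §1 (the quantities `A, C, D, E, 𝐈(ω)`),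
  Def. 2.1, Lemma 2.6, §3 ("by translating in space-time and rescaling"). [AlbrittonBarker2019]
* B. Pineau, V. Vicol, arXiv:2607.09619 (2026), (1.7), Conjecture 1.1, Remark 1.5 (RSS ⊆ DSS
  with `λ = e^{π/|α|}`). [PineauVicol2026]
-/

noncomputable section

-- the registered stub namespace repeats the summit name `NavierStokesRegularity` (summit = problem)
set_option linter.dupNamespace false

namespace Summit.NavierStokesRegularity.NavierStokesRegularity.Theorems.FrequencyRigidity.ScaledEnergySplit

open Literature.Analysis.FluidPDE MeasureTheory Set Filter Topology Function Metric
open scoped ENNReal NNReal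

variable {u u' : ℝ → EuclideanSpace ℝ (Fin 3) → EuclideanSpace ℝ (Fin 3)}
  {p p' : ℝ → EuclideanSpace ℝ (Fin 3) → ℝ}
  {G G' : ℝ → EuclideanSpace ℝ (Fin 3) → EuclideanSpace ℝ (Fin 3) →L[ℝ] EuclideanSpace ℝ (Fin 3)}
  {r : ℝ} {z : ℝ × EuclideanSpace ℝ (Fin 3)} {ω : Set (ℝ × EuclideanSpace ℝ (Fin 3))}

/-! ## The A–B quantities only see the fields on the ball / region -/

/-- `D(Q(z, r))` only sees the pressure on the ball `Q(z, r)` (the means `[q]_{x,r}(t')` are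
taken over time slices of the ball). [cite: AlbrittonBarker2019, §1 (display defining D)] -/
theorem rssTIB_cknDOsc_congr (h : ∀ w ∈ parabolicCylinder r z, p w.1 w.2 = p' w.1 w.2) :
    cknDOsc r z p = cknDOsc r z p' := by
  unfold cknDOsc
  congr 1
  refine setLIntegral_congr_fun (isOpen_parabolicCylinder r z).measurableSet fun w hw => ?_
  have hw' := mem_parabolicCylinder.1 hw
  have havg : ⨍ y in ball z.2 r, p w.1 y = ⨍ y in ball z.2 r, p' w.1 y := by
    refine setAverage_congr_fun measurableSet_ball (Eventually.of_forall fun y hy => ?_)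
    exact h (w.1, y) (mem_parabolicCylinder.2 ⟨hw'.1, mem_ball.1 hy⟩)
  simp only [h w hw, havg]

/-- `E(Q(z, r))` only sees the gradient field on the ball `Q(z, r)`. [folklore] -/
theorem rssTIB_cknE_congr (h : ∀ w ∈ parabolicCylinder r z, G w.1 w.2 = G' w.1 w.2) :
    cknE r z G = cknE r z G' := by
  unfold cknE
  congr 1
  exact setLIntegral_congr_fun (isOpen_parabolicCylinder r z).measurableSet fun w hw => by
    simp only [h w hw]

/-- `(A + C + D + E)(Q(z, r))` only sees the three fields on the ball `Q(z, r)`.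
[cite: AlbrittonBarker2019, §1 (displays defining A, C, D, E)] -/
theorem rssTIB_abScaledSum_congr
    (hu : ∀ w ∈ parabolicCylinder r z, u w.1 w.2 = u' w.1 w.2)
    (hp : ∀ w ∈ parabolicCylinder r z, p w.1 w.2 = p' w.1 w.2)
    (hG : ∀ w ∈ parabolicCylinder r z, G w.1 w.2 = G' w.1 w.2) :
    abScaledSum r z u p G = abScaledSum r z u' p' G' := by
  have hae : ∀ᵐ w ∂(volume.restrict (parabolicCylinder r z)), uncurry u w = uncurry u' w :=
    ae_restrict_of_forall_mem (isOpen_parabolicCylinder r z).measurableSet fun w hw => hu w hw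
  rw [abScaledSum_congr_ae (p := p) (G := G) hae]
  unfold abScaledSum
  rw [rssTIB_cknDOsc_congr hp, rssTIB_cknE_congr hG]

/-- `𝐈(ω)` only sees the three fields on `ω` (every admissible ball lies in `ω`).
[cite: AlbrittonBarker2019, §1 (display defining 𝐈(ω))] -/
theorem rssTIB_typeIBound_congr
    (hu : ∀ w ∈ ω, u w.1 w.2 = u' w.1 w.2) (hp : ∀ w ∈ ω, p w.1 w.2 = p' w.1 w.2)
    (hG : ∀ w ∈ ω, G w.1 w.2 = G' w.1 w.2) :
    typeIBound ω u p G = typeIBound ω u' p' G' := by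
  unfold typeIBound
  refine iSup_congr fun r => iSup_congr fun _ => iSup_congr fun z => iSup_congr fun hz => ?_
  exact rssTIB_abScaledSum_congr (fun w hw => hu w (hz hw)) (fun w hw => hp w (hz hw))
    (fun w hw => hG w (hz hw))

/-! ## Gauge invariance: `𝐈` on the lower half space does not see functions of time -/

/-- The times of an admissible ball `Q(z, r) ⊆ ω ⊆ ℝ³ × ℝ₋`, `r > 0`, are negative. [folklore] -/
theorem rssTIB_time_neg (hω : ω ⊆ Iio (0 : ℝ) ×ˢ univ) (hz : parabolicCylinder r z ⊆ ω)
    (hr : 0 < r) {t : ℝ} (ht : t ∈ Ioo (z.1 - r ^ 2) z.1) : t < 0 := by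
  have h : (t, z.2) ∈ parabolicCylinder r z :=
    mem_parabolicCylinder.2 ⟨ht, by rw [dist_self]; exact hr⟩
  exact (hω (hz h)).1

/-- **Gauge invariance of `𝐈` on regions of the lower half space.** If the slices `p(t, ·)`,
`t < 0`, are continuous, subtracting any function of time from the pressure does not change
`𝐈(ω)`, `ω ⊆ ℝ³ × ℝ₋`: `D` is mean-free (`cknDOsc_sub_fun_time`), the slices being integrable on
balls (Albritton–Barker 2019, §1: the pressure of an ancient solution is only determined up
to a function of time, which `D` does not see).
[cite: AlbrittonBarker2019, §1 (display defining D)] -/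
theorem rssTIB_typeIBound_sub_fun_time (hω : ω ⊆ Iio (0 : ℝ) ×ˢ univ)
    (hp : ∀ t < 0, Continuous (p t)) (e : ℝ → ℝ) :
    typeIBound ω u (fun t x => p t x - e t) G = typeIBound ω u p G := by
  unfold typeIBound
  refine iSup_congr fun r => iSup_congr fun hr => iSup_congr fun z => iSup_congr fun hz => ?_
  unfold abScaledSum
  rw [cknDOsc_sub_fun_time hr e]
  refine ae_restrict_of_forall_mem measurableSet_Ioo fun t ht => ?_
  exact ((hp t (rssTIB_time_neg hω hz hr ht)).continuousOn.integrableOn_compact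
    (isCompact_closedBall z.2 r)).mono_set ball_subset_closedBall

/-! ## Discrete self-similarity of the RSS flow and of its zoomed triple on `t < 0` -/

/-- **Pineau–Vicol 2026, Remark 1.5 (RSS ⊆ DSS).** The RSS ansatz field with a time-independent
profile is discretely self-similar with some factor `λ > 1`: `λ = e^{π/|α|}` for `α ≠ 0`
(`2α log λ = ±2π`), any `λ > 1` for `α = 0`. [cite: PineauVicol2026, Remark 1.5] -/
theorem rssTIB_exists_dss (α : ℝ) (U : EuclideanSpace ℝ (Fin 3) → EuclideanSpace ℝ (Fin 3)) :
    ∃ l : ℝ, 1 < l ∧ IsDiscretelySelfSimilar l (pvAnsatz α (fun y _ => U y)) := by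
  by_cases hα : α = 0
  · refine ⟨2, one_lt_two, isDiscretelySelfSimilar_pvAnsatz two_pos (fun θ v => ?_) U⟩
    rw [hα, zero_mul, add_zero]
  · exact ⟨Real.exp (Real.pi / |α|), Real.one_lt_exp_iff.2 (div_pos Real.pi_pos (abs_pos.2 hα)),
      isDiscretelySelfSimilar_pvAnsatz (Real.exp_pos _)
        (fun θ v => rotZ_add_eq_self_of_exp_pi_div_abs hα θ v) U⟩

variable {α c : ℝ} {U : EuclideanSpace ℝ (Fin 3) → EuclideanSpace ℝ (Fin 3)}

/-- On `t < 0` the flow inherits the discrete self-similarity of the ansatz field: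
`u(t, ·) = c u(c² t, c ·)`. [cite: PineauVicol2026, Remark 1.5] -/
theorem rssTIB_slice_eq
    (hA : ∀ t ∈ Iio (0 : ℝ), ∀ x, u t x = pvAnsatz α (fun y _ => U y) t x) (hc : 0 < c)
    (hdss : IsDiscretelySelfSimilar c (pvAnsatz α (fun y _ => U y))) {t : ℝ} (ht : t < 0) :
    u t = fun x => c • u (c ^ 2 * t) (c • x) := by
  have hct : c ^ 2 * t < 0 := mul_neg_of_pos_of_neg (by positivity) ht
  funext x
  have h := congrFun (congrFun hdss t) x
  rw [nsRescale_apply] at h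
  rw [hA t ht x, ← h, hA _ hct]

/-- Hence `u_c(t) = u(t)` for `t < 0`, `u_c = c u(c² ·, c ·)` the Leray rescaling. [folklore] -/
theorem rssTIB_nsRescale_slice_eq
    (hA : ∀ t ∈ Iio (0 : ℝ), ∀ x, u t x = pvAnsatz α (fun y _ => U y) t x) (hc : 0 < c)
    (hdss : IsDiscretelySelfSimilar c (pvAnsatz α (fun y _ => U y))) {t : ℝ} (ht : t < 0) :
    nsRescale c u t = u t := by
  rw [rssTIB_slice_eq hA hc hdss ht]
  rfl

/-- The zoomed velocity `c u(c² t, c x)` (accepted vocabulary `c • stPull (c²) c 0 0 u`) agrees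
with `u` on the lower half space. [folklore] -/
theorem rssTIB_zoom_velocity_eq
    (hA : ∀ t ∈ Iio (0 : ℝ), ∀ x, u t x = pvAnsatz α (fun y _ => U y) t x) (hc : 0 < c)
    (hdss : IsDiscretelySelfSimilar c (pvAnsatz α (fun y _ => U y)))
    (w : ℝ × EuclideanSpace ℝ (Fin 3))
    (hw : w ∈ Iio (0 : ℝ) ×ˢ (univ : Set (EuclideanSpace ℝ (Fin 3)))) :
    (c • stPull (c ^ 2) c 0 0 u) w.1 w.2 = u w.1 w.2 := by
  have ht : w.1 < 0 := hw.1
  rw [rssTIB_slice_eq hA hc hdss ht]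
  simp only [Pi.smul_apply, stPull_apply, zero_add]

/-- The zoomed gradient `c² (∇u)(c² t, c x)` agrees with `∇u` on the lower half space (chain
rule on the slice `u(t, ·) = c u(c² t, c ·)`). [folklore] -/
theorem rssTIB_zoom_gradient_eq (hsol : IsClassicalNSSolutionOn (Iio (0 : ℝ)) 1 0 u p)
    (hA : ∀ t ∈ Iio (0 : ℝ), ∀ x, u t x = pvAnsatz α (fun y _ => U y) t x) (hc : 0 < c)
    (hdss : IsDiscretelySelfSimilar c (pvAnsatz α (fun y _ => U y)))
    (w : ℝ × EuclideanSpace ℝ (Fin 3))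
    (hw : w ∈ Iio (0 : ℝ) ×ˢ (univ : Set (EuclideanSpace ℝ (Fin 3)))) :
    (c ^ 2 • stPull (c ^ 2) c 0 0 (fun t x => fderiv ℝ (u t) x)) w.1 w.2 =
      fderiv ℝ (u w.1) w.2 := by
  have ht : w.1 < 0 := hw.1
  have hct : c ^ 2 * w.1 < 0 := mul_neg_of_pos_of_neg (by positivity) ht
  have hd : Differentiable ℝ (u (c ^ 2 * w.1)) :=
    (hsol.contDiff_velocity hct).differentiable (by simp)
  have hdc : DifferentiableAt ℝ
      (fun x : EuclideanSpace ℝ (Fin 3) => u (c ^ 2 * w.1) (c • x)) w.2 := by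
    fun_prop
  simp only [Pi.smul_apply, stPull_apply, zero_add]
  rw [rssTIB_slice_eq hA hc hdss ht, fderiv_fun_const_smul hdc, fderiv_comp_smul, smul_smul, sq]

/-- The rescaled time set of `(−∞, 0)` is `(−∞, 0)`. [folklore] -/
theorem rssTIB_preimage_Iio (hc : 0 < c) : (fun t : ℝ => c ^ 2 * t) ⁻¹' Iio (0 : ℝ) = Iio 0 := by
  ext s
  simp only [mem_preimage, mem_Iio]
  constructor
  · intro h
    by_contra hs
    have : 0 ≤ c ^ 2 * s := mul_nonneg (sq_nonneg c) (not_lt.1 hs)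
    linarith
  · exact fun h => mul_neg_of_pos_of_neg (by positivity) h

/-- **The zoomed pressure differs from `p` by a function of time.** Both `(u, p)` and the Leray
rescaling `(u_c, p_c)`, `p_c = c² p(c² ·, c ·)` (`IsClassicalNSSolutionOn.nsRescale_holds`),
solve the equations on `(−∞, 0)` with the same velocity there, so their pressure gradients
agree (`pressure_sub_apply_zero_eq_of_eventuallyEq`): `p_c(t, x) = p(t, x) − (p(t, 0) − p_c(t, 0))`.
[folklore] -/
theorem rssTIB_zoom_pressure_eq (hsol : IsClassicalNSSolutionOn (Iio (0 : ℝ)) 1 0 u p)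
    (hA : ∀ t ∈ Iio (0 : ℝ), ∀ x, u t x = pvAnsatz α (fun y _ => U y) t x) (hc : 0 < c)
    (hdss : IsDiscretelySelfSimilar c (pvAnsatz α (fun y _ => U y)))
    (w : ℝ × EuclideanSpace ℝ (Fin 3))
    (hw : w ∈ Iio (0 : ℝ) ×ˢ (univ : Set (EuclideanSpace ℝ (Fin 3)))) :
    (c ^ 2 • stPull (c ^ 2) c 0 0 p) w.1 w.2 =
      p w.1 w.2 - (p w.1 0 - c ^ 2 * p (c ^ 2 * w.1) 0) := by
  have ht : w.1 < 0 := hw.1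
  have h1 := IsClassicalNSSolutionOn.nsRescale_holds hsol hc
  rw [nsRescaleForce_zero, rssTIB_preimage_Iio hc] at h1
  have heq : ∀ᶠ τ in 𝓝 w.1, nsRescale c u τ = u τ :=
    eventually_of_mem (Iio_mem_nhds ht) fun τ hτ => rssTIB_nsRescale_slice_eq hA hc hdss hτ
  have h2 := h1.pressure_sub_apply_zero_eq_of_eventuallyEq hsol (Iio_mem_nhds ht)
    (Iio_mem_nhds ht) heq w.2
  simp only [nsRescalePressure_apply, smul_zero] at h2
  simp only [Pi.smul_apply, stPull_apply, zero_add, smul_eq_mul]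
  linarith

/-! ## Scale invariance of `𝐈` of the balls at the vertex -/

/-- A parabolic ball at the vertex lies in the lower half space. [folklore] -/
theorem rssTIB_ball_zero_subset_lowerHalf (R : ℝ) :
    parabolicCylinder R (0 : ℝ × EuclideanSpace ℝ (Fin 3)) ⊆ Iio (0 : ℝ) ×ˢ univ :=
  parabolicCylinder_subset_lowerHalf (Prod.fst_zero (M := ℝ) (N := EuclideanSpace ℝ (Fin 3))).le R

/-- **One zoom step** (A–B §3, "by translating in space-time and rescaling"): if the ansatz field
is `c`-DSS then `𝐈(Q(0, cR); u, p, ∇u) = 𝐈(Q(0, R); u, p, ∇u)`: by `typeIBound_nsZoom` the left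
side is `𝐈(Q(0, R))` of the zoomed triple, which on `Q(0, R) ⊆ ℝ³ × ℝ₋` is `(u, p − e(t), ∇u)`.
[cite: AlbrittonBarker2019, §3] -/
theorem rssTIB_typeIBound_ball_zoom (hsol : IsClassicalNSSolutionOn (Iio (0 : ℝ)) 1 0 u p)
    (hA : ∀ t ∈ Iio (0 : ℝ), ∀ x, u t x = pvAnsatz α (fun y _ => U y) t x) (hc : 0 < c)
    (hdss : IsDiscretelySelfSimilar c (pvAnsatz α (fun y _ => U y))) (R : ℝ) :
    typeIBound (parabolicCylinder (c * R) 0) u p (fun t x => fderiv ℝ (u t) x) =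
      typeIBound (parabolicCylinder R 0) u p (fun t x => fderiv ℝ (u t) x) := by
  have hlow := rssTIB_ball_zero_subset_lowerHalf R
  rw [← typeIBound_nsZoom hc 0 0 (parabolicCylinder (c * R) 0) u p _,
    stAffine_preimage_parabolicCylinder_zero hc, mul_div_cancel_left₀ R hc.ne',
    rssTIB_typeIBound_congr (G' := fun t x => fderiv ℝ (u t) x)
      (p' := fun t x => p t x - (p t 0 - c ^ 2 * p (c ^ 2 * t) 0))
      (fun w hw => rssTIB_zoom_velocity_eq hA hc hdss w (hlow hw))
      (fun w hw => rssTIB_zoom_pressure_eq hsol hA hc hdss w (hlow hw))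
      (fun w hw => rssTIB_zoom_gradient_eq hsol hA hc hdss w (hlow hw))]
  exact rssTIB_typeIBound_sub_fun_time hlow (fun t ht => (hsol.contDiff_pressure ht).continuous) _

/-! ## A–B Lemma 2.6 at the vertex -/

/-- **`𝐈(Q((0,0), 1/2)) < ∞`** from A–B Lemma 2.6, `A`-case (`albrittonBarker2019_lemma_2_6_holds`)
applied to the suitable pair `(u, p − c(t))` in `Q((0,0), 1)` with the classical slice derivative
as weak gradient; the gauge `c(t)` is then removed (`rssTIB_typeIBound_sub_fun_time`).
[cite: AlbrittonBarker2019, Lemma 2.6 (arXiv:1811.00502 §2)] -/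
theorem rssTIB_typeIBound_half_lt_top (hsol : IsClassicalNSSolutionOn (Iio (0 : ℝ)) 1 0 u p)
    {c : ℝ → ℝ} (hsw : IsSuitableWeakSolutionInBall 1 0 u (fun t x => p t x - c t))
    (hM : ∃ M : ℝ≥0, ∀ (r : ℝ) (z : ℝ × EuclideanSpace ℝ (Fin 3)), 0 < r →
      parabolicCylinder r z ⊆ parabolicCylinder 1 0 → cknAEss r z u ≤ M) :
    typeIBound (parabolicCylinder (1 / 2) 0) u p (fun t x => fderiv ℝ (u t) x) < ⊤ := by
  obtain ⟨M, hM⟩ := hM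
  have hG : HasWeakSpatialGradientOn (parabolicCylinderOpens 1 (0 : ℝ × EuclideanSpace ℝ (Fin 3))) u
      (fun t x => fderiv ℝ (u t) x) :=
    hasWeakSpatialGradientOn_of_contDiffOn isOpen_Iio
      (by rw [coe_parabolicCylinderOpens]; exact rssTIB_ball_zero_subset_lowerHalf 1)
      (hsol.smooth_velocity.of_le (by norm_cast))
  have hAcase : (⨆ (r : ℝ) (_ : 0 < r) (z' : ℝ × EuclideanSpace ℝ (Fin 3))
      (_ : parabolicCylinder r z' ⊆ parabolicCylinder 1 (0 : ℝ × EuclideanSpace ℝ (Fin 3))),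
        cknAEss r z' u) < ∞ := by
    refine lt_of_le_of_lt ?_ (ENNReal.coe_lt_top (r := M))
    exact iSup_le fun r => iSup_le fun hr => iSup_le fun z' => iSup_le fun hz' => hM r z' hr hz'
  have h26 := albrittonBarker2019_lemma_2_6_holds 0 u (fun t x => p t x - c t) hsw _ hG
    (Or.inl hAcase) (1 / 2) (by norm_num) (by norm_num)
  rwa [rssTIB_typeIBound_sub_fun_time (rssTIB_ball_zero_subset_lowerHalf _)
    (fun t ht => (hsol.contDiff_pressure ht).continuous) c] at h26

/-! ## The stub -/

/-- **Stub `stub_rssTypeIBoundOfBall` (line `scaled-energy-split`).** A classical unforced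
unit-viscosity Navier–Stokes flow on `(−∞, 0) × ℝ³` which is Pineau–Vicol's rotated self-similar
ansatz field for `t < 0`, suitable in the unit parabolic ball at the vertex in Albritton–Barker's
class for some pressure gauge `p − c(t)` and with `A` bounded on its sub-balls, has finite
Albritton–Barker quantity `𝐈(ℝ³ × ℝ₋) < ∞`: Lemma 2.6 gives `𝐈(Q(0, 1/2)) < ∞`, discrete
self-similarity (Remark 1.5) and the scale and gauge invariance of `𝐈` give
`𝐈(Q(0, λ^k/2)) = 𝐈(Q(0, 1/2))`, and the balls `Q(0, λ^k/2)` exhaust `ℝ³ × ℝ₋`.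
[cite: AlbrittonBarker2019, Lemma 2.6 and §3] -/
theorem stub_rssTypeIBoundOfBall : ∀ (α : ℝ) (U : EuclideanSpace ℝ (Fin 3) → EuclideanSpace ℝ (Fin 3)) (u : ℝ → EuclideanSpace ℝ (Fin 3) → EuclideanSpace ℝ (Fin 3)) (p : ℝ → EuclideanSpace ℝ (Fin 3) → ℝ) (c : ℝ → ℝ), Literature.Analysis.FluidPDE.IsClassicalNSSolutionOn (Set.Iio 0) 1 0 u p → (∀ t ∈ Set.Iio (0:ℝ), ∀ x, u t x = Literature.Analysis.FluidPDE.pvAnsatz α (fun y _ => U y) t x) → Literature.Analysis.FluidPDE.IsSuitableWeakSolutionInBall 1 0 u (fun t x => p t x - c t) → (∃ M : NNReal, ∀ (r : ℝ) (z : ℝ × EuclideanSpace ℝ (Fin 3)), 0 < r → Literature.Analysis.FluidPDE.parabolicCylinder r z ⊆ Literature.Analysis.FluidPDE.parabolicCylinder 1 0 → Literature.Analysis.FluidPDE.cknAEss r z u ≤ M) → Literature.Analysis.FluidPDE.typeIBound (Set.Iio (0:ℝ) ×ˢ Set.univ) u p (fun t x => fderiv ℝ (u t) x) < ⊤ :=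 by
  intro α U u p c hsol hA hsw hM
  have hhalf := rssTIB_typeIBound_half_lt_top hsol hsw hM
  obtain ⟨l, hl, hdss⟩ := rssTIB_exists_dss α U
  have hl0 : 0 < l := zero_lt_one.trans hl
  -- all dilated balls at the vertex have the same `𝐈`
  have hk : ∀ k : ℕ, typeIBound (parabolicCylinder (l ^ k * (1 / 2)) 0) u p
      (fun t x => fderiv ℝ (u t) x) =
        typeIBound (parabolicCylinder (1 / 2) 0) u p (fun t x => fderiv ℝ (u t) x) :=
    fun k => rssTIB_typeIBound_ball_zoom hsol hA (pow_pos hl0 k)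
      (ChaeWolf.isDiscretelySelfSimilar_pow hdss k) (1 / 2)
  refine lt_of_le_of_lt (typeIBound_le_iff.2 fun r hr z hz => ?_) hhalf
  -- the ball `Q(z, r)` of the lower half space lies in some `Q(0, l^k/2)`
  have hz0 : z.1 ≤ 0 := by
    by_contra hpos
    push Not at hpos
    set ε := min (r ^ 2 / 2) (z.1 / 2) with hε
    have hε1 : ε ≤ r ^ 2 / 2 := min_le_left _ _
    have hε2 : ε ≤ z.1 / 2 := min_le_right _ _
    have hε0 : 0 < ε := lt_min (by positivity) (by linarith)
    have hw : (z.1 - ε, z.2) ∈ parabolicCylinder r z :=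
      mem_parabolicCylinder.2 ⟨⟨by dsimp only; nlinarith [sq_nonneg r], by dsimp only; linarith⟩,
        by rw [dist_self]; exact hr⟩
    have h' : z.1 - ε < 0 := (hz hw).1
    linarith
  set a : ℝ := ‖z.2‖ + r + Real.sqrt (r ^ 2 - z.1) + 1 with ha
  have ha0 : 0 ≤ a := by rw [ha]; positivity
  obtain ⟨k, hk'⟩ := pow_unbounded_of_one_lt (2 * a) hl
  have hsub : parabolicCylinder r z ⊆ parabolicCylinder (l ^ k * (1 / 2)) 0 :=
    (parabolicCylinder_subset_origin hz0 hr).trans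
      (parabolicCylinder_mono ha0 (by linarith) 0)
  calc abScaledSum r z u p (fun t x => fderiv ℝ (u t) x)
      ≤ typeIBound (parabolicCylinder (l ^ k * (1 / 2)) 0) u p (fun t x => fderiv ℝ (u t) x) :=
        abScaledSum_le_typeIBound hr hsub
    _ = typeIBound (parabolicCylinder (1 / 2) 0) u p (fun t x => fderiv ℝ (u t) x) := hk k
    _ ≤ typeIBound (parabolicCylinder (1 / 2) 0) u p (fun t x => fderiv ℝ (u t) x) := le_rfl

end Summit.NavierStokesRegularity.NavierStokesRegularity.Theorems.FrequencyRigidity.ScaledEnergySplit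

end
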